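import Literature.NumberTheory.Automorphic.StrongMultiplicityOneSpherical
import Literature.NumberTheory.Automorphic.UnramifiedHeckeScalarsProofs
import HarnessLib

/-!
# The spherical Hecke algebra at `v` acts by scalars on the vectors spherical at `v` (proof
modulo the `K(𝔫)`-level fact); assembly of lang.S22 from lang.S20 and one `GL_n` fact

Topic `NumberTheory/Automorphic`; sibling proof file of `StrongMultiplicityOneSpherical`,
discharging its named fact `Flath1979_heckeOperatorAt_sphericalLevelAt_eq_smul` (**SF'**: for a
cuspidal `Π`, a finite place `v` and `g ∈ GL_n(K_v)`, the operator
`[GL_n(𝒪_v) ι_v(g) GL_n(𝒪_v)]` acts on `Π^{GL_n(𝒪_v)}` by a scalar) *modulo* the older and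
weaker-looking named fact `Flath1979_heckeOperatorAt_ofLocal_eq_smul` of `UnramifiedHeckeScalars`
(**SF**: the same at the levels `K(𝔫)`, `v ∤ 𝔫`):

* `Flath1979_heckeOperatorAt_sphericalLevelAt_eq_smul_of_ofLocal_eq_smul : SF → SF'`.

So SF and SF' are equivalent (`Flath1979_heckeOperatorAt_ofLocal_eq_smul_of_sphericalLevelAt` is
the converse), and after this file the inputs of the assembled global Jacquet–Langlands
correspondence `Literature.NumberTheory.Automorphic.jacquetLanglands_global` (lang.S22) are the three quaternionic parts of
`JacquetLanglandsParts`, lang.S20 (`strong_multiplicity_one_gl`) and SF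
(`Literature.NumberTheory.Automorphic.jacquetLanglands_global_of_parts''`); likewise strong multiplicity one at the local
spherical levels follows from lang.S20 and SF alone
(`Literature.NumberTheory.Automorphic.strong_multiplicity_one_gl_sphericalLevel_of_strong_multiplicity_one_gl'`).

## The proof of `SF → SF'`

The analytic input is the density of `⋃_{v ∤ 𝔫} Π^{K(𝔫)}` in `Π^{GL_n(𝒪_v)}`, obtained
without Haar measure from the results of `UnramifiedHeckeScalarsProofs`:

1. `exists_principalCongruenceLevel_not_dvd_mul_ofLocal_inv_mem` (**levels prime to `v`**): every
   neighbourhood `U` of `1` in `GL_n(𝔸_K)` contains, for each finite `v`, some `K(𝔫₀)`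
   (`exists_principalCongruenceLevel_subset`); writing `𝔫₀ = 𝔭_v^e 𝔫` with `𝔭_v ∤ 𝔫` (Mathlib
   `WfDvdMonoid.max_power_factor`), every `k ∈ K(𝔫)` satisfies `k ι_v(k_v)⁻¹ ∈ K(𝔫₀) ⊆ U`
   (`k ι_v(k_v)⁻¹` is `1` at `v` and `k` at `w ≠ v`, where `|𝔫₀|_w = |𝔫|_w`,
   `idealRadius_pow_mul_of_ne`), i.e. `K(𝔫) ⊆ U · ι_v(GL_n(𝒪_v))`.
2. `ClosedSubrep.exists_fixedVectors_not_dvd_norm_sub_le` (**density**): for `f ∈ W` spherical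
   at `v` and `ε > 0`, with `U = {g | ‖R(g) f - f‖ < ε}` (strong continuity,
   `isStronglyContinuous_rightRegular_holds`) and `𝔫` as in 1, the whole `K(𝔫)`-orbit of `f`
   is `ε`-close to `f` (`R(k) f = R(k ι_v(k_v)⁻¹) f`), so the minimal-norm point of its closed
   convex hull is a `K(𝔫)`-fixed `w ∈ W` with `‖w - f‖ ≤ ε`
   (`ClosedSubrep.exists_mem_fixedVectors_norm_sub_le`).
3. `continuous_heckeOperatorAt`: a double-coset operator `[Kf g Kf]` on a closed
   subrepresentation is continuous (a finite sum of the continuous `π(y)`, or the junk value `0`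
   when `Kf g Kf / Kf` is infinite, `heckeOperator_eq_zero_of_infinite`).
4. Algebra: on `Π^{K(𝔫)}`, `v ∤ 𝔫`, the operator `T = [GL_n(𝒪_v) ι_v(g) GL_n(𝒪_v)]` is
   `[K(𝔫) ι_v(g) K(𝔫)]` (`heckeOperator_sphericalLevelAt_eq_principalCongruenceLevel`), a scalar
   `c(𝔫)` by SF; two such scalars agree as soon as the fixed spaces are non-zero (compare on
   `Π^{K(𝔫𝔫₀)} ⊇ Π^{K(𝔫)} + Π^{K(𝔫₀)}`, `principalCongruenceLevel_mono`), so one `c` serves all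
   `𝔫`; then `{u | T u = c u}` is closed (3) and contains a dense subset of `Π^{GL_n(𝒪_v)}` (2).

## Design notes

* Theorems only: no definition, instance or named fact is added. `continuous_heckeOperatorAt`
  is stated for an arbitrary `ContRepresentation` on a topological module (librarian candidate
  for `AutomorphicSpectrum`, next to `heckeOperatorAt`); the two level lemmas of step 1 are
  librarian candidates for `GLnAdelicStructure`.
* The assembly theorems keep the binder shape of `jacquetLanglands_global_of_parts'`
  (families over all automorphic measures).

## References

* A. Borel, H. Jacquet, *Automorphic forms and automorphic representations*, Proc. Sympos.
  Pure Math. 33 (Corvallis 1979), Part 1, §4.6 [BorelJacquetCorvallis1979].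
* D. Flath, *Decomposition of representations into tensor products*, Corvallis (1979), Part 1,
  Thm. 3 [FlathCorvallis1979].
* J. R. Getz, H. Hahn, *An introduction to automorphic representations, with a view toward
  trace formulae*, GTM 300 (2024), Lemma 5.3.3 (p. 102), Cor. 5.5.2, Thm. 5.7.1–5.7.2, §7.1
  [GetzHahn2024].
* D. Bump, *Automorphic forms and representations* (1997), §3.3.
-/

noncomputable section

open scoped MatrixGroups RestrictedProduct
open NumberField IsDedekindDomain MeasureTheory Filter Topology Set

namespace Literature.NumberTheory.Automorphic

/-! ### Continuity of the double-coset Hecke operators -/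

section HeckeContinuous

variable {k G V : Type*} [CommRing k] [Group G] [AddCommGroup V] [TopologicalSpace V]
  [IsTopologicalAddGroup V] [Module k V] {π : ContRepresentation k G V}

/-- The Hecke operator `[Kf g Kf]` on a closed subrepresentation is continuous: a finite sum of
the continuous operators `π(y)` if the double coset is a finite union of left cosets, the junk
value `0` otherwise (`heckeOperator_eq_zero_of_infinite`). [folklore] -/
theorem continuous_heckeOperatorAt (W : ContRepresentation.ClosedSubrep π) (Kf : Subgroup G)
    (g : G) : Continuous (heckeOperatorAt W Kf g) := by
  classical
  by_cases hfin : (MulAction.orbit Kf (g : G ⧸ Kf)).Finite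
  · unfold heckeOperatorAt heckeOperator
    rw [finsum_mem_eq_finite_toFinset_sum _ hfin]
    refine (continuous_finsetSum hfin.toFinset
      fun y _ => (W.toContRep y.out).continuous).congr fun x => ?_
    rw [LinearMap.sum_apply]
    rfl
  · unfold heckeOperatorAt
    rw [heckeOperator_eq_zero_of_infinite _ Kf g hfin]
    exact continuous_const

end HeckeContinuous

/-! ### Levels prime to `v` inside a neighbourhood of `1` -/

section PrimeToV

variable (n : ℕ) (K : Type) [Field K] [NumberField K]

/-- `|𝔭_v^e 𝔪|_w = |𝔪|_w` at every finite place `w ≠ v` (`ord_w 𝔭_v = 0`; Mathlib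
`FractionalIdeal.count_mul`, `count_pow`, `count_maximal_coprime`). [folklore] -/
theorem idealRadius_pow_mul_of_ne {v w : HeightOneSpectrum (𝓞 K)} (hw : w ≠ v) (e : ℕ)
    {𝔪 : Ideal (𝓞 K)} (h𝔪 : 𝔪 ≠ 0) :
    idealRadius K w (v.asIdeal ^ e * 𝔪) = idealRadius K w 𝔪 := by
  have hv0 : ((v.asIdeal : Ideal (𝓞 K)) : FractionalIdeal (nonZeroDivisors (𝓞 K)) K) ^ e ≠ 0 :=
    pow_ne_zero _ (FractionalIdeal.coeIdeal_ne_zero.mpr v.ne_bot)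
  have h𝔪0 : ((𝔪 : Ideal (𝓞 K)) : FractionalIdeal (nonZeroDivisors (𝓞 K)) K) ≠ 0 :=
    FractionalIdeal.coeIdeal_ne_zero.mpr h𝔪
  unfold idealRadius
  rw [FractionalIdeal.coeIdeal_mul, FractionalIdeal.coeIdeal_pow,
    FractionalIdeal.count_mul K w hv0 h𝔪0, FractionalIdeal.count_pow,
    FractionalIdeal.count_maximal_coprime K w (Ne.symm hw), mul_zero, zero_add]

/-- **Levels prime to `v`.** Every neighbourhood `U` of `1` in `GL_n(𝔸_K)` swallows, for each
finite place `v`, a principal congruence subgroup `K(𝔫)` with `𝔫 ≠ 0` *prime to `v`*, up to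
the local spherical factor at `v`: every `k ∈ K(𝔫)` is `k = k₁ · ι_v(k_v)` with `k₁ ∈ U`
(namely `k₁ = k ι_v(k_v)⁻¹`, trivial at `v`). Proof: `U ⊇ K(𝔫₀)`
(`exists_principalCongruenceLevel_subset`); write `𝔫₀ = 𝔭_v^e 𝔫` with `𝔭_v ∤ 𝔫` (Mathlib
`WfDvdMonoid.max_power_factor`); for `k ∈ K(𝔫)`, `k ι_v(k_v)⁻¹` is `1` at `v` and equals `k`
at `w ≠ v`, where `|𝔫₀|_w = |𝔫|_w` (`idealRadius_pow_mul_of_ne`), so it lies in `K(𝔫₀) ⊆ U`.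
(Bump §3.3; Borel–Jacquet (1979), §4.6: `K(𝔫) = GL_n(𝒪_v) · K(𝔫)^{(v)}` for `v ∤ 𝔫`.)
[folklore] -/
theorem exists_principalCongruenceLevel_not_dvd_mul_ofLocal_inv_mem (v : HeightOneSpectrum (𝓞 K))
    {U : Set (GL (Fin n) (AdeleRing (𝓞 K) K))} (hU : U ∈ 𝓝 (1 : GL (Fin n) (AdeleRing (𝓞 K) K))) :
    ∃ 𝔫 : Ideal (𝓞 K), 𝔫 ≠ 0 ∧ ¬ v.asIdeal ∣ 𝔫 ∧
      ∀ k ∈ principalCongruenceLevel n K 𝔫,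
        k * (GLn.ofLocal n K v ((AdelicGroupData.gl n K).toLocal v k))⁻¹ ∈ U := by
  obtain ⟨𝔫₀, h𝔫₀, hK⟩ := exists_principalCongruenceLevel_subset n K hU
  obtain ⟨e, 𝔫, hv𝔫, h𝔫₀eq⟩ := WfDvdMonoid.max_power_factor h𝔫₀ v.irreducible
  have h𝔫 : 𝔫 ≠ 0 := by
    rintro rfl
    exact h𝔫₀ (by rw [h𝔫₀eq, mul_zero])
  refine ⟨𝔫, h𝔫, hv𝔫, fun k hk => hK ?_⟩
  rw [SetLike.mem_coe, h𝔫₀eq, mem_principalCongruenceLevel_iff]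
  obtain ⟨hkint, hkw⟩ := mem_principalCongruenceLevel_iff.mp hk
  have hkv : (AdelicGroupData.gl n K).toLocal v k ∈
      valuedCongruenceSubgroup (Fin n) (1 : WithZero (Multiplicative ℤ)) :=
    toLocal_mem_valuedCongruenceSubgroup_one hkint v
  have hs : GLn.ofLocal n K v ((AdelicGroupData.gl n K).toLocal v k) ∈
      principalCongruenceLevel n K 𝔫 :=
    isMaximalAt_principalCongruenceLevel n K v h𝔫 hv𝔫 ⟨_, hkv, rfl⟩
  refine ⟨(glIntegralLevel n K).mul_mem hkint
    ((glIntegralLevel n K).inv_mem (principalCongruenceLevel_le n K 𝔫 hs)), fun w => ?_⟩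
  show Matrix.GeneralLinearGroup.map (AdelicGroupData.adeleEval K w)
      (k * (GLn.ofLocal n K v ((AdelicGroupData.gl n K).toLocal v k))⁻¹) ∈
    valuedCongruenceSubgroup (Fin n) (idealRadius K w (v.asIdeal ^ e * 𝔫))
  rw [map_mul, map_inv]
  by_cases hw : w = v
  · subst hw
    rw [GLn.map_adeleEval_ofLocal]
    show (AdelicGroupData.gl n K).toLocal w k * ((AdelicGroupData.gl n K).toLocal w k)⁻¹ ∈ _
    rw [mul_inv_cancel]
    exact one_mem _
  · have h1 : Matrix.GeneralLinearGroup.map (AdelicGroupData.adeleEval K w)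
        (GLn.ofLocal n K v ((AdelicGroupData.gl n K).toLocal v k)) = 1 :=
      GLn.toLocal_ofLocal_of_ne hw _
    have hkw' : Matrix.GeneralLinearGroup.map (AdelicGroupData.adeleEval K w) k ∈
        valuedCongruenceSubgroup (Fin n) (idealRadius K w 𝔫) := hkw w
    rw [h1, inv_one, mul_one, idealRadius_pow_mul_of_ne K hw e h𝔫]
    exact hkw'

end PrimeToV

/-! ### Density of the vectors of level prime to `v` among the vectors spherical at `v` -/

section Density

variable {n : ℕ} {K : Type} [Field K] [NumberField K]
  {μ : Measure (AdelicGroupData.gl n K).automorphicQuotient}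
  [(AdelicGroupData.gl n K).IsAutomorphicMeasure μ]

/-- **Vectors of level `K(𝔫)`, `v ∤ 𝔫`, are dense in the vectors spherical at `v`.** Let
`W ≤ L²(GL_n(𝔸_K) ⧸ A_G GL_n(K))` be a closed invariant subspace and `f ∈ W` fixed by the
local spherical level `GL_n(𝒪_v) ↪ GL_n(𝔸_K)`. For every `ε > 0` there are `𝔫 ≠ 0` prime to
`v` and a `K(𝔫)`-fixed `w ∈ W` with `‖w - f‖ ≤ ε`. Proof: `U = {g | ‖R(g) f - f‖ < ε}` is a
neighbourhood of `1` (strong continuity); choose `𝔫` prime to `v` with `k ι_v(k_v)⁻¹ ∈ U` for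
`k ∈ K(𝔫)` (`exists_principalCongruenceLevel_not_dvd_mul_ofLocal_inv_mem`); as `ι_v(k_v)`
fixes `f`, `R(k) f = R(k ι_v(k_v)⁻¹) f` is `ε`-close to `f` for all `k ∈ K(𝔫)`, and
`ClosedSubrep.exists_mem_fixedVectors_norm_sub_le` gives `w` (Borel–Jacquet (1979), §4.6;
Getz–Hahn (2024), Lemma 5.3.3). [folklore] -/
theorem ClosedSubrep.exists_fixedVectors_not_dvd_norm_sub_le
    (W : ContRepresentation.ClosedSubrep ((AdelicGroupData.gl n K).rightRegular μ))
    (v : HeightOneSpectrum (𝓞 K)) {f : W.toSubmodule}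
    (hf : f ∈ W.fixedVectors (Literature.NumberTheory.Automorphic.sphericalLevelAt K n v)) {ε : ℝ} (hε : 0 < ε) :
    ∃ 𝔫 : Ideal (𝓞 K), 𝔫 ≠ 0 ∧ ¬ v.asIdeal ∣ 𝔫 ∧
      ∃ w ∈ W.fixedVectors (principalCongruenceLevel n K 𝔫),
        ‖((w : W.toSubmodule) : (AdelicGroupData.gl n K).L2 μ) - f‖ ≤ ε := by
  have hU : (fun g : (AdelicGroupData.gl n K).Adelic =>
      ((AdelicGroupData.gl n K).rightRegular μ) g (f : (AdelicGroupData.gl n K).L2 μ)) ⁻¹'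
        Metric.ball (f : (AdelicGroupData.gl n K).L2 μ) ε ∈
      𝓝 (1 : (AdelicGroupData.gl n K).Adelic) := by
    have h1 : Continuous fun g : (AdelicGroupData.gl n K).Adelic =>
        ((AdelicGroupData.gl n K).rightRegular μ) g (f : (AdelicGroupData.gl n K).L2 μ) :=
      (AdelicGroupData.gl n K).isStronglyContinuous_rightRegular_holds μ _
    refine h1.continuousAt.preimage_mem_nhds ?_
    have e :
        ((AdelicGroupData.gl n K).rightRegular μ) 1 (f : (AdelicGroupData.gl n K).L2 μ) = f := by
      rw [map_one]
      rfl
    show Metric.ball (f : (AdelicGroupData.gl n K).L2 μ) ε ∈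
      𝓝 (((AdelicGroupData.gl n K).rightRegular μ) 1 (f : (AdelicGroupData.gl n K).L2 μ))
    rw [e]
    exact Metric.ball_mem_nhds _ hε
  obtain ⟨𝔫, h𝔫, hv, hK⟩ := exists_principalCongruenceLevel_not_dvd_mul_ofLocal_inv_mem n K v hU
  refine ⟨𝔫, h𝔫, hv, ?_⟩
  refine ClosedSubrep.exists_mem_fixedVectors_norm_sub_le W (principalCongruenceLevel n K 𝔫) f.2
    (r := ε) fun k hk => ?_
  set s : GL (Fin n) (AdeleRing (𝓞 K) K) :=
    GLn.ofLocal n K v ((AdelicGroupData.gl n K).toLocal v k) with hs_def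
  have hs : s ∈ Literature.NumberTheory.Automorphic.sphericalLevelAt K n v :=
    ⟨_, toLocal_mem_valuedCongruenceSubgroup_one (principalCongruenceLevel_le n K 𝔫 hk) v, rfl⟩
  have hsf : ((AdelicGroupData.gl n K).rightRegular μ) s (f : (AdelicGroupData.gl n K).L2 μ) = f :=
    congrArg Subtype.val (((ContRepresentation.ClosedSubrep.mem_fixedVectors W _ f).mp hf) s hs)
  have hsf' :
      ((AdelicGroupData.gl n K).rightRegular μ) s⁻¹ (f : (AdelicGroupData.gl n K).L2 μ) = f := by
    have h := congrArg (((AdelicGroupData.gl n K).rightRegular μ) s⁻¹) hsf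
    rw [← h]
    show
      (((AdelicGroupData.gl n K).rightRegular μ) s⁻¹ * ((AdelicGroupData.gl n K).rightRegular μ) s)
        (f : (AdelicGroupData.gl n K).L2 μ) = f
    rw [← map_mul, inv_mul_cancel, map_one]
    rfl
  have e : ((AdelicGroupData.gl n K).rightRegular μ) k (f : (AdelicGroupData.gl n K).L2 μ) =
      ((AdelicGroupData.gl n K).rightRegular μ) (k * s⁻¹) (f : (AdelicGroupData.gl n K).L2 μ) := by
    have h := congrArg (fun T : (AdelicGroupData.gl n K).L2 μ →L[ℂ] (AdelicGroupData.gl n K).L2 μ =>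
      T (f : (AdelicGroupData.gl n K).L2 μ))
      (map_mul ((AdelicGroupData.gl n K).rightRegular μ) k s⁻¹)
    refine (h.trans ?_).symm
    show ((AdelicGroupData.gl n K).rightRegular μ) k
        (((AdelicGroupData.gl n K).rightRegular μ) s⁻¹ (f : (AdelicGroupData.gl n K).L2 μ)) =
      ((AdelicGroupData.gl n K).rightRegular μ) k f
    rw [hsf']
  rw [e]
  exact Metric.ball_subset_closedBall (hK k hk)

end Density

/-! ### The spherical Hecke algebra acts by scalars: SF implies SF' -/

section Spherical

variable {n : ℕ} {K : Type} [Field K] [NumberField K]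
  {μ : Measure (AdelicGroupData.gl n K).automorphicQuotient}
  [(AdelicGroupData.gl n K).IsAutomorphicMeasure μ]

/-- **SF implies SF'.** If the unramified local Hecke operators at `v` act by scalars on the
`K(𝔫)`-fixed vectors of cuspidal representations for all `𝔫 ≠ 0` prime to `v`
(`Flath1979_heckeOperatorAt_ofLocal_eq_smul`, the named fact of `UnramifiedHeckeScalars`), then
they act by scalars on all vectors spherical at `v`
(`Flath1979_heckeOperatorAt_sphericalLevelAt_eq_smul` of `StrongMultiplicityOneSpherical`).
Proof: the operator `T = [GL_n(𝒪_v) ι_v(g) GL_n(𝒪_v)]` agrees with `[K(𝔫) ι_v(g) K(𝔫)]` on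
`Π^{K(𝔫)}` (`heckeOperator_sphericalLevelAt_eq_principalCongruenceLevel`), where it is a scalar
`c(𝔫)`; these scalars agree (compare on `Π^{K(𝔫𝔫₀)} ⊇ Π^{K(𝔫)} + Π^{K(𝔫₀)}`), so `T = c` on
`⋃_{v ∤ 𝔫} Π^{K(𝔫)}`, which is dense in `Π^{GL_n(𝒪_v)}`
(`ClosedSubrep.exists_fixedVectors_not_dvd_norm_sub_le`); and `T` is continuous
(`continuous_heckeOperatorAt`). [folklore] -/
theorem Flath1979_heckeOperatorAt_sphericalLevelAt_eq_smul_of_ofLocal_eq_smul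
    (hF : Flath1979_heckeOperatorAt_ofLocal_eq_smul (n := n) (K := K) (μ := μ)) :
    Flath1979_heckeOperatorAt_sphericalLevelAt_eq_smul (n := n) (K := K) (μ := μ) := by
  intro P v g
  classical
  set T := heckeOperatorAt P.1 (Literature.NumberTheory.Automorphic.sphericalLevelAt K n v) (GLn.ofLocal n K v g) with hT
  -- Step 1: `T` is a scalar `c(𝔫)` on each `Π^{K(𝔫)}`, `v ∤ 𝔫`
  have hTK : ∀ 𝔫 : Ideal (𝓞 K), 𝔫 ≠ 0 → ¬ v.asIdeal ∣ 𝔫 → ∃ c : ℂ,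
      ∀ u ∈ P.1.fixedVectors (principalCongruenceLevel n K 𝔫), T u = c • u := by
    intro 𝔫 h𝔫 hv
    obtain ⟨c, hc⟩ := hF P h𝔫 hv g
    refine ⟨c, fun u hu => ?_⟩
    rw [← hc u hu]
    exact heckeOperator_sphericalLevelAt_eq_principalCongruenceLevel
      P.1.toContRep.toRepresentation h𝔫 hv g hu
  -- Step 2: one scalar for all levels prime to `v`
  have key : ∃ c : ℂ, ∀ 𝔫 : Ideal (𝓞 K), 𝔫 ≠ 0 → ¬ v.asIdeal ∣ 𝔫 →
      ∀ u ∈ P.1.fixedVectors (principalCongruenceLevel n K 𝔫), T u = c • u := by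
    by_cases hex : ∃ 𝔫₀ : Ideal (𝓞 K), 𝔫₀ ≠ 0 ∧ ¬ v.asIdeal ∣ 𝔫₀ ∧
        P.1.fixedVectors (principalCongruenceLevel n K 𝔫₀) ≠ ⊥
    · obtain ⟨𝔫₀, h𝔫₀, hv₀, hne⟩ := hex
      obtain ⟨u₀, hu₀, hu₀0⟩ := (Submodule.ne_bot_iff _).mp hne
      obtain ⟨c, hc⟩ := hTK 𝔫₀ h𝔫₀ hv₀
      refine ⟨c, fun 𝔫 h𝔫 hv u hu => ?_⟩
      have h0 : 𝔫 * 𝔫₀ ≠ 0 := mul_ne_zero h𝔫 h𝔫₀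
      obtain ⟨c', hc'⟩ := hTK (𝔫 * 𝔫₀) h0 fun h => (v.prime.dvd_or_dvd h).elim hv hv₀
      have hu' : u ∈ P.1.fixedVectors (principalCongruenceLevel n K (𝔫 * 𝔫₀)) :=
        P.1.fixedVectors_antitone (principalCongruenceLevel_mono n K h0 Ideal.mul_le_right) hu
      have hu₀' : u₀ ∈ P.1.fixedVectors (principalCongruenceLevel n K (𝔫 * 𝔫₀)) :=
        P.1.fixedVectors_antitone (principalCongruenceLevel_mono n K h0 Ideal.mul_le_left) hu₀
      have e1 : c' = c := smul_left_injective ℂ hu₀0 ((hc' u₀ hu₀').symm.trans (hc u₀ hu₀))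
      rw [← e1]
      exact hc' u hu'
    · refine ⟨0, fun 𝔫 h𝔫 hv u hu => ?_⟩
      have hu0 : u = 0 := by
        by_contra hne
        exact hex ⟨𝔫, h𝔫, hv, (Submodule.ne_bot_iff _).mpr ⟨u, hu, hne⟩⟩
      rw [hu0, map_zero, smul_zero]
  obtain ⟨c, hc⟩ := key
  refine ⟨c, fun f hf => ?_⟩
  -- Step 3: density and continuity
  have hcont : Continuous fun u : P.1.toSubmodule => T u - c • u :=
    (continuous_heckeOperatorAt P.1 _ _).sub (continuous_id.const_smul c)
  have hclosed : IsClosed {u : P.1.toSubmodule | T u - c • u = 0} :=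
    isClosed_eq hcont continuous_const
  suffices hmem : f ∈ closure {u : P.1.toSubmodule | T u - c • u = 0} by
    rw [hclosed.closure_eq] at hmem
    exact sub_eq_zero.mp hmem
  rw [Metric.mem_closure_iff]
  intro ε hε
  obtain ⟨𝔫, h𝔫, hv, w, hw, hwf⟩ :=
    ClosedSubrep.exists_fixedVectors_not_dvd_norm_sub_le P.1 v hf (half_pos hε)
  refine ⟨w, sub_eq_zero.mpr (hc 𝔫 h𝔫 hv w hw), ?_⟩
  rw [dist_comm, dist_eq_norm, ← Submodule.norm_coe, Submodule.coe_sub]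
  linarith

/-- **SF and SF' are equivalent**: the scalar action of the unramified local Hecke operators at
`v` on the `K(𝔫)`-fixed vectors (`v ∤ 𝔫`) of cuspidal representations and on their vectors
spherical at `v` are the same statement
(`Flath1979_heckeOperatorAt_ofLocal_eq_smul_of_sphericalLevelAt`,
`Flath1979_heckeOperatorAt_sphericalLevelAt_eq_smul_of_ofLocal_eq_smul`). [folklore] -/
theorem Flath1979_heckeOperatorAt_sphericalLevelAt_eq_smul_iff :
    Flath1979_heckeOperatorAt_sphericalLevelAt_eq_smul (n := n) (K := K) (μ := μ) ↔
      Flath1979_heckeOperatorAt_ofLocal_eq_smul (n := n) (K := K) (μ := μ) :=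
  ⟨Flath1979_heckeOperatorAt_ofLocal_eq_smul_of_sphericalLevelAt,
    Flath1979_heckeOperatorAt_sphericalLevelAt_eq_smul_of_ofLocal_eq_smul⟩

end Spherical

end Literature.NumberTheory.Automorphic

namespace Literature.NumberTheory.Automorphic


/-! ### Consequences: spherical strong multiplicity one and lang.S22 from lang.S20 and SF -/

section Assembly

variable {n : ℕ} {K : Type} [Field K] [NumberField K]

/-- **Strong multiplicity one at the local spherical levels from lang.S20 and SF.** The tree's
`strong_multiplicity_one_gl` (lang.S20) and the scalar fact
`Flath1979_heckeOperatorAt_ofLocal_eq_smul` (SF), each for every automorphic measure, imply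
`strong_multiplicity_one_gl_sphericalLevel n K`
(`strong_multiplicity_one_gl_sphericalLevel_of_strong_multiplicity_one_gl` with SF' from
`Flath1979_heckeOperatorAt_sphericalLevelAt_eq_smul_of_ofLocal_eq_smul` and the level fact from
`exists_fixedVectors_principalCongruenceLevel_ne_bot_holds`). [folklore] -/
theorem strong_multiplicity_one_gl_sphericalLevel_of_strong_multiplicity_one_gl'
    (hSMO : ∀ (μ : Measure (AdelicGroupData.gl n K).automorphicQuotient)
      [(AdelicGroupData.gl n K).IsAutomorphicMeasure μ],
      strong_multiplicity_one_gl (n := n) (K := K) (μ := μ))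
    (hSF : ∀ (μ : Measure (AdelicGroupData.gl n K).automorphicQuotient)
      [(AdelicGroupData.gl n K).IsAutomorphicMeasure μ],
      Flath1979_heckeOperatorAt_ofLocal_eq_smul (n := n) (K := K) (μ := μ)) :
    strong_multiplicity_one_gl_sphericalLevel n K :=
  strong_multiplicity_one_gl_sphericalLevel_of_strong_multiplicity_one_gl hSMO
    (fun μ _ => Flath1979_heckeOperatorAt_sphericalLevelAt_eq_smul_of_ofLocal_eq_smul (hSF μ))
    (fun _ _ => exists_fixedVectors_principalCongruenceLevel_ne_bot_holds)

universe u

variable (K) (D : Type u) [Ring D] [Algebra K D] [IsQuaternionAlgebra K D]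

/-- **Assembly of lang.S22, third form.** The three quaternionic parts of
`JacquetLanglandsParts` — existence of the transfer (`jacquetLanglands_transfer_exists`:
Gelbart (1975), Thm. 10.5 (i); JL Thm. 14.4, 15.1), rigidity
(`strong_multiplicity_one_quaternionUnits`: Gelbart Thm. 10.5 (ii) with Thm. 10.10) and
surjectivity (`jacquetLanglands_transfer_surjective`: Gelbart Thm. 10.5 (ii); JL Thm. 16.1) —
together with **lang.S20** (`strong_multiplicity_one_gl` for `GL₂`) and the single `GL₂` fact
**SF** (`Flath1979_heckeOperatorAt_ofLocal_eq_smul`: the unramified local Hecke algebras act by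
scalars on `Π^{K(𝔫)}`) imply the global Jacquet–Langlands correspondence
`jacquetLanglands_global` as vendored (`jacquetLanglands_global_of_parts'` with SF' and the
level fact now proved). [folklore] -/
theorem jacquetLanglands_global_of_parts''
    (hT : jacquetLanglands_transfer_exists K D)
    (hR : strong_multiplicity_one_quaternionUnits K D)
    (hS : jacquetLanglands_transfer_surjective K D)
    (hSMO : ∀ (μ : Measure (AdelicGroupData.gl 2 K).automorphicQuotient)
      [(AdelicGroupData.gl 2 K).IsAutomorphicMeasure μ],
      strong_multiplicity_one_gl (n := 2) (K := K) (μ := μ))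
    (hSF : ∀ (μ : Measure (AdelicGroupData.gl 2 K).automorphicQuotient)
      [(AdelicGroupData.gl 2 K).IsAutomorphicMeasure μ],
      Flath1979_heckeOperatorAt_ofLocal_eq_smul (n := 2) (K := K) (μ := μ)) :
    jacquetLanglands_global K D :=
  jacquetLanglands_global_of_parts' K D hT hR hS hSMO
    (fun μ _ => Flath1979_heckeOperatorAt_sphericalLevelAt_eq_smul_of_ofLocal_eq_smul (hSF μ))
    (fun _ _ => exists_fixedVectors_principalCongruenceLevel_ne_bot_holds)

end Assembly

end Literature.NumberTheory.Automorphic
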